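import Summits.QuantumFields.BalabanUV.Beta.FP.ConstrainedBiLaplacianPairing
import Summits.QuantumFields.BalabanUV.Beta.GAN24.SubAveragingUnitTower

/-!
# `BalabanUV.Beta.FP.ConstrainedBiLaplacianSubcell` — road «FP» for binder row D1, DESIGN ROW **GHOST-STEP** brick (g3) «(CONV-C)-Sb»
# (owner d1-p3 gen 13, `HOME/b2b-balaban-beta-d1-p3/N2B-DESIGN.md` v1.2 §3 Q-FP-13-2 → gan24-p3 ∕ row G-an2-4), FILE 1 — THE j-UNIFORM HALF:
# THE TWO-LEG SUB-CELL AVERAGE OF THE CONSTRAINED INVERSE OF `(Δ^ξ)^s` HAS AN EXPONENTIAL MAJORANT WITH LEVEL-FREE RATE AND PREFACTOR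
# (`‖latticeKernel (avgM n L s τ σ) x‖ ≤ 4^{d+1}·Kop·(L^{d+1})⁻¹·e^{−kappaB·|x|_∞}` for EVERY coarse level `n ≥ 1` and EVERY refinement `L ≥ 1`)

NOT IN PRINT; OUR PROOF ATTEMPT (binder row G-an2-4 ∕ (CONV-C), prover part P3 = fibre∕strip «Woodbury» lineage, gen 28; CRUX TEAM (2),
ruling «YM REDIRECT TOWARDS THE SUMMIT» ∕ «YM ACCELERATION», 2026-08-21).  HONEST DEPENDENCY (cell records, verbatim): «continuum YM on T⁴ ⇐
BetaPertH ∧ nine spine estimates (0/9 proved); BetaPertH ⇐ (D1) ∧ (D4) ∧ CAP+tail; G-an2-4 gates asym, D1 and NE2/3/4.»  HONEST FRAMING (cell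
contract, verbatim): «discharging `BetaPertH` makes Bałaban's UV stability UNCONDITIONAL — a real constructive-QFT result; it is NOT the continuum
limit and NOT the Clay problem.»  ABSOLUTE RULE (cell charter, verbatim): «No internally-minted statement may enter as a cited fact. Every hypothesis
is either kernel-proved in this package or a verbatim quotation of a PUBLISHED theorem with page reference. The manuscript(s) under audit are NOT
citable for their own disputed steps — they are the thing under adjudication; programme-internal (2001/route/tribunal) claims are never citable.»
THIS MODULE is [folklore] bookkeeping over the lineage's FILES 3b ∕ 4c of row RHOA-4-GH (`FP/ConstrainedBiLaplacianKernel` — the offset-pair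
multiplier `M n s τ σ`; `FP/ConstrainedBiLaplacianPairing` — `Phi`, `latticeKernel_Phi`, `pairing_decay`, `stripRegular_Phi`) and the lineage's
`GAN24/SubAveragingUnitTower` (`Tsub`, `sum_Tsub_eq`); it re-defines no symbol of [B4], cites nothing as a hypothesis, has no `def … : Prop`, no `sorry`.

## The question answered (Q-FP-13-2, journal «LOCATED + TWO QUESTIONS» 2026-08-21T13:53:46Z; INBOX [D1P3-G13-Q1])

Road FP's perfect-level closed form of `E♭_m` needs the scalar (CONV-C)-type row «the unit-rescaled `dec (Lc^j)` of an2's `Sb_{Lc^{j+m}}` (both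
legs block-summed) converges entrywise as `j → ∞` with a `j`-UNIFORM EXPONENTIAL MAJORANT».  In the lineage's alias-fibre currency the
block-constrained inverse of `(Δ^ξ)^s` at fine level `N` (unit blocks, fine spacing `ξ = 1∕N`; `s = 2` the ghost's bi-Laplacian) has the fine-pair
entries `latticeKernel (M N s τ σ) (x⁰ − y⁰)` (FILE 2a §0 dictionary; unit-lattice currency `× N^{2s}`).  Decimating BOTH legs by `L` at level
`N = n·L` averages the entries over the `L^{d+1} × L^{d+1}` finer offset pairs inside a pair of level-`n` fine cells `(τ, σ)`:
**`avgM n L s τ σ := (L^{d+1})⁻² Σ_{ρρ′} M (n·L) s (Tsub τ ρ) (Tsub σ ρ′)`** (§2).  THIS FILE PROVES the uniform half of the row for this object,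
for EVERY `d`, `s`, `n ≥ 1`, `L ≥ 1`:

* `avgM_eq_Phi` — the two-leg cell average IS the pairing multiplier of FILE 4c against the two normalised cell indicators `cellVec` (§1,
  `sqNorm_cellVec = (L^{d+1})⁻¹`); hence `stripRegular_avgM` (strip-regular on `Strip (d+1) (kappaB (d+1) s)` with bound
  `4^{d+1}·Kop (d+1) s·(L^{d+1})⁻¹`), the dictionary `latticeKernel_avgM` (the kernel of the average is the average of the kernels), and
* **`subcell_decay`**: `‖latticeKernel (avgM n L s τ σ) x‖ ≤ 4^{d+1}·Kop (d+1) s·((L:ℝ)^{d+1})⁻¹·e^{−kappaB (d+1) s·|x|_∞}` — rate AND prefactor free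
  of the coarse level `n` and decreasing in the refinement `L` (`pairing_decay` BY NAME);
* **`subcell_decay_scaled`** ∕ **`subcell_tower_uniform`**: the same multiplied by `L^{d+1}` — `‖(L^{d+1})·latticeKernel (avgM n L s τ σ) x‖ ≤
  4^{d+1}·Kop·e^{−kappaB|x|_∞}` for ALL `L ≥ 1` — which is the `j`-UNIFORM MAJORANT of Q-FP-13-2 read at `n := Lc^m` (the cells are the
  `Lc^{m(d+1)}` sub-cells of side `Lc^{−m}` of the constraint block), `L := Lc^j → ∞`: in unit-lattice currency the doubly block-summed entries of
  the constrained inverse at fine level `Lc^{j+m}` over `Lc^j`-blocks are `(Lc^{j+m})^{2s}·(Lc^j)^{2(d+1)}·latticeKernel (avgM (Lc^m) (Lc^j) s τ σ)`, so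
  the «unit rescaling» that makes them `j`-bounded is `× (Lc^j)^{−(d+1)−2s}` (`= Lc^{−8j}` at `(d+1, s) = (4, 2)`), leaving the `j`-free factor
  `Lc^{2sm}` — every power displayed, nothing hidden.

WHY TWO AVERAGED LEGS (honest, located by the lineage before): the single fine-pair entries are NOT `N`-uniform in unit currency at `(d+1, s) = (4, 2)`
(FILE 3b's `boundM` carries the located `Lam N ≍ log N` — the coincident-point variance of the 4-D membrane); census row V40 of the lineage records the
same for `s = 1` (fine × fine (CONV-C) shapes fail at the diagonal).  The OPERATOR ∕ pairing currency of FILE 4c is `N`-free, and two cell-averaged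
legs are exactly a pairing against `ℓ²`-small test vectors — this file is that remark made a theorem.

NOT HERE (honest; the other halves of Q-FP-13-2, first refusal kept by this lineage): (ii) the CONVERGENCE ∕ one-step RATE of the fixed-cell tower
`L ↦ (L^{d+1})·latticeKernel (avgM n L s τ σ)` (the two-leg analogue of the lineage's `GAN24/SubAveragingKernel.subavg_kernel_rate`; the exact
level-free phase bookkeeping of `SubAveragingSplitting.subavg_numerator` applies leg by leg, the core estimate for the Sherman–Morrison entries at
order `s` is not written); (iii) the JUNCTION of `latticeKernel (M N s τ σ)` with an2's `BiLaplaceBlockKKT.Sb` (by `BiLaplaceBlockGreen.eq_Sb_of_solvesB`: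
EL row, zero block sums, temperedness of the fibre kernel).  0∕4 row-D1 binders touched.  NOT (CONV-C) (a list), NEVER «G-an2-4 closed», NOT the
ghost step law, NOT SDF, NOT D1, NOT BetaPertH, NOT continuum, NOT Clay.  Provenance: prover-b2b-balaban-gan24-p3-g28-0 (unit `b2b-balaban-gan24-p3`,
gen 28), 2026-08-21; no existing file touched.
-/

noncomputable section

namespace Summit.QuantumFields.BalabanUV.Beta.FP.ConstrainedBiLaplacianSubcell

open Complex Finset ComplexConjugate
open Literature.MathematicalPhysics.QuantumFieldTheory.Balaban1983to89
open Literature.MathematicalPhysics.QuantumFieldTheory.Balaban1983to89.B4Strip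
open Literature.MathematicalPhysics.QuantumFieldTheory.Balaban1983to89.B4StripCauchy
open Literature.MathematicalPhysics.QuantumFieldTheory.Balaban1983to89.B4ContourShift
open Literature.MathematicalPhysics.QuantumFieldTheory.Balaban1983to89.B5Strip145Decay
open Summit.QuantumFields.BalabanUV.Beta.FP.ConstrainedBiLaplacianStrip
open Summit.QuantumFields.BalabanUV.Beta.FP.ConstrainedBiLaplacianKernel
open Summit.QuantumFields.BalabanUV.Beta.FP.ConstrainedBiLaplacianParseval
open Summit.QuantumFields.BalabanUV.Beta.FP.ConstrainedBiLaplacianFibreOperator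
open Summit.QuantumFields.BalabanUV.Beta.FP.ConstrainedBiLaplacianPairing
open Summit.QuantumFields.BalabanUV.Beta.GAN24.SubAveragingKernel (Tsub Tsub_val)
open Summit.QuantumFields.BalabanUV.Beta.GAN24.SubAveragingUnitTower (sum_Tsub_eq Tsub_injective)
open scoped Real

variable {d : ℕ}

/-! ## §1 The normalised cell indicator as an offset vector of the finer level -/

/-- [folklore] The level-`n` cell of a finer offset `T ∈ (Fin (n·L))^d`: coordinatewise integer division by `L`. -/
def cellOf (n L : ℕ) [NeZero L] (T : Fin d → Fin (n * L)) : Fin d → Fin n := fun ν =>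
  ⟨(T ν : ℕ) / L, Nat.div_lt_of_lt_mul ((T ν).isLt.trans_eq (Nat.mul_comm n L))⟩

/-- [folklore] `cellOf (Tsub τ ρ) = τ` (`(L·τ_ν + ρ_ν) ∕ L = τ_ν` since `ρ_ν < L`). -/
theorem cellOf_Tsub (n L : ℕ) [NeZero L] (τ : Fin d → Fin n) (ρ : Fin d → Fin L) : cellOf n L (Tsub n L τ ρ) = τ := by
  funext ν
  apply Fin.ext
  show (((Tsub n L τ ρ ν : Fin (n * L)) : ℕ)) / L = (τ ν : ℕ)
  rw [Tsub_val]
  have hL : 0 < L := Nat.pos_of_ne_zero (NeZero.ne L)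
  rw [Nat.mul_add_div hL, Nat.div_eq_of_lt (ρ ν).isLt, Nat.add_zero]

/-- [folklore] **THE NORMALISED CELL INDICATOR** `cellVec n L τ T = (L^d)⁻¹·[T ∈ cell τ]` — the offset vector of the finer level `n·L` against
which a cell AVERAGE is a pairing. -/
def cellVec (n L : ℕ) [NeZero L] (τ : Fin d → Fin n) (T : Fin d → Fin (n * L)) : ℂ :=
  if cellOf n L T = τ then ((L : ℂ) ^ d)⁻¹ else 0

/-- [folklore] On the finer sites of the cell `τ′` the indicator of the cell `τ` reads `[τ′ = τ]·(L^d)⁻¹`. -/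
theorem cellVec_Tsub (n L : ℕ) [NeZero L] (τ τ' : Fin d → Fin n) (ρ : Fin d → Fin L) :
    cellVec n L τ (Tsub n L τ' ρ) = if τ' = τ then ((L : ℂ) ^ d)⁻¹ else 0 := by
  unfold cellVec
  rw [cellOf_Tsub]

/-- [folklore] The cell indicator is real: `conj (cellVec n L τ T) = cellVec n L τ T`. -/
theorem conj_cellVec (n L : ℕ) [NeZero L] (τ : Fin d → Fin n) (T : Fin d → Fin (n * L)) :
    conj (cellVec n L τ T) = cellVec n L τ T := by
  unfold cellVec
  split_ifs
  · rw [map_inv₀, map_pow, Complex.conj_natCast]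
  · exact map_zero _

/-- [folklore] **PAIRING AGAINST THE CELL INDICATOR IS THE CELL AVERAGE**: `Σ_T cellVec n L τ T · h T = (L^d)⁻¹ Σ_ρ h (Tsub τ ρ)`. -/
theorem sum_cellVec_mul (n L : ℕ) [NeZero L] (τ : Fin d → Fin n) (h : (Fin d → Fin (n * L)) → ℂ) :
    ∑ T : Fin d → Fin (n * L), cellVec n L τ T * h T = ((L : ℂ) ^ d)⁻¹ * ∑ ρ : Fin d → Fin L, h (Tsub n L τ ρ) := by
  rw [sum_Tsub_eq n L (fun T => cellVec n L τ T * h T)]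
  have e : ∀ τ' : Fin d → Fin n, ∑ ρ : Fin d → Fin L, cellVec n L τ (Tsub n L τ' ρ) * h (Tsub n L τ' ρ)
      = if τ' = τ then ((L : ℂ) ^ d)⁻¹ * ∑ ρ : Fin d → Fin L, h (Tsub n L τ ρ) else 0 := fun τ' => by
    simp_rw [cellVec_Tsub]
    split_ifs with hτ
    · subst hτ; rw [Finset.mul_sum]
    · simp
  simp_rw [e]
  rw [Finset.sum_ite_eq' Finset.univ τ, if_pos (Finset.mem_univ τ)]

/-- [folklore] The conjugated form of `sum_cellVec_mul` (the indicator is real). -/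
theorem sum_conj_cellVec_mul (n L : ℕ) [NeZero L] (τ : Fin d → Fin n) (h : (Fin d → Fin (n * L)) → ℂ) :
    ∑ T : Fin d → Fin (n * L), conj (cellVec n L τ T) * h T = ((L : ℂ) ^ d)⁻¹ * ∑ ρ : Fin d → Fin L, h (Tsub n L τ ρ) := by
  simp_rw [conj_cellVec]
  exact sum_cellVec_mul n L τ h

/-- [folklore] **THE CELL INDICATOR IS `ℓ²`-SMALL**: `sqNorm (cellVec n L τ) = (L^d)⁻¹` (`L^d` sites of weight `L^{−2d}`). -/
theorem sqNorm_cellVec (n L : ℕ) [NeZero L] (τ : Fin d → Fin n) : sqNorm (cellVec n L τ) = ((L : ℝ) ^ d)⁻¹ := by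
  have hL : (L : ℝ) ≠ 0 := Nat.cast_ne_zero.mpr (NeZero.ne L)
  unfold sqNorm
  have e1 : ∀ T : Fin d → Fin (n * L), (‖cellVec n L τ T‖ ^ 2 : ℝ) = (cellVec n L τ T * cellVec n L τ T).re := fun T => by
    nth_rewrite 3 [← conj_cellVec n L τ T]
    rw [Complex.mul_conj, Complex.ofReal_re, Complex.normSq_eq_norm_sq]
  simp_rw [e1]
  rw [← Complex.re_sum, sum_cellVec_mul n L τ (cellVec n L τ)]
  simp_rw [cellVec_Tsub, if_true]
  rw [Finset.sum_const, Finset.card_univ, Fintype.card_pi, Fintype.card_fin, Finset.prod_const, Finset.card_univ,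
    Fintype.card_fin, nsmul_eq_mul]
  push_cast
  rw [← Complex.ofReal_natCast, ← Complex.ofReal_pow, ← Complex.ofReal_inv, ← Complex.ofReal_mul, ← Complex.ofReal_mul,
    Complex.ofReal_re]
  field_simp

/-! ## §2 The two-leg sub-cell average of the finer offset-pair multiplier -/

/-- [folklore] **THE TWO-LEG SUB-CELL AVERAGE** of the level-`n·L` offset-pair multiplier of the constrained inverse of `(Δ^ξ)^s` over the
`L^d × L^d` finer offset pairs inside the pair of level-`n` cells `(τ, σ)`:
`avgM n L s τ σ p = (L^d)⁻¹·(L^d)⁻¹·Σ_{ρρ′} M (n·L) s (Tsub τ ρ) (Tsub σ ρ′) p`. -/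
def avgM (n L : ℕ) [NeZero n] [NeZero L] (s : ℕ) (τ σ : Fin d → Fin n) (p : Fin d → ℂ) : ℂ :=
  ((L : ℂ) ^ d)⁻¹ * (((L : ℂ) ^ d)⁻¹ *
    ∑ ρ : Fin d → Fin L, ∑ ρ' : Fin d → Fin L, M (n * L) s (Tsub n L τ ρ) (Tsub n L σ ρ') p)

/-- [folklore] **THE CELL AVERAGE IS A PAIRING**: `avgM n L s τ σ p = Phi (n·L) s (cellVec τ) (cellVec σ) p`. -/
theorem avgM_eq_Phi (n L : ℕ) [NeZero n] [NeZero L] (s : ℕ) (τ σ : Fin d → Fin n) (p : Fin d → ℂ) :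
    avgM n L s τ σ p = Phi (n * L) s (cellVec n L τ) (cellVec n L σ) p := by
  unfold Phi avgM
  have e : ∀ T : Fin d → Fin (n * L), ∑ T' : Fin d → Fin (n * L), conj (cellVec n L τ T) * cellVec n L σ T' * M (n * L) s T T' p
      = conj (cellVec n L τ T) * (((L : ℂ) ^ d)⁻¹ * ∑ ρ' : Fin d → Fin L, M (n * L) s T (Tsub n L σ ρ') p) := fun T => by
    rw [← sum_cellVec_mul n L σ (fun T' => M (n * L) s T T' p), Finset.mul_sum]
    refine Finset.sum_congr rfl fun T' _ => ?_
    ring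
  simp_rw [e]
  rw [sum_conj_cellVec_mul n L τ (fun T => ((L : ℂ) ^ d)⁻¹ * ∑ ρ' : Fin d → Fin L, M (n * L) s T (Tsub n L σ ρ') p),
    ← Finset.mul_sum]

/-- [folklore] The same as an equality of functions of the momentum. -/
theorem avgM_eq_Phi' (n L : ℕ) [NeZero n] [NeZero L] (s : ℕ) (τ σ : Fin d → Fin n) :
    avgM n L s τ σ = Phi (n * L) s (cellVec n L τ) (cellVec n L σ) :=
  funext (avgM_eq_Phi n L s τ σ)

/-- [folklore] The product of the two cell indicators' `ℓ²` norms: `√(L^{-d})·√(L^{-d}) = (L^d)⁻¹`. -/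
theorem sqrt_sqNorm_cellVec_mul (n L : ℕ) [NeZero L] (τ σ : Fin d → Fin n) :
    Real.sqrt (sqNorm (cellVec n L τ)) * Real.sqrt (sqNorm (cellVec n L σ)) = ((L : ℝ) ^ d)⁻¹ := by
  rw [sqNorm_cellVec, sqNorm_cellVec]
  exact Real.mul_self_sqrt (by positivity)

/-! ## §3 Strip regularity, the kernel dictionary and the LEVEL-FREE decay (dimension `d+1`) -/

/-- [folklore] **STRIP REGULARITY OF THE TWO-LEG CELL AVERAGE** on `Strip (d+1) (kappaB (d+1) s)` with the bound `4^{d+1}·Kop·(L^{d+1})⁻¹`,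
for every `n, L ≥ 1`. -/
theorem stripRegular_avgM (n L : ℕ) [NeZero n] [NeZero L] (s : ℕ) (τ σ : Fin (d + 1) → Fin n) :
    StripRegular (d := d) (avgM n L s τ σ) (kappaB (d + 1) s) (4 ^ (d + 1) * Kop (d + 1) s * ((L : ℝ) ^ (d + 1))⁻¹) := by
  rw [avgM_eq_Phi', ← sqrt_sqNorm_cellVec_mul n L τ σ]
  exact stripRegular_Phi (n * L) s (cellVec n L τ) (cellVec n L σ)

/-- [folklore] **THE KERNEL OF THE AVERAGE IS THE AVERAGE OF THE KERNELS**: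
`latticeKernel (avgM n L s τ σ) x = (L^{d+1})⁻¹·(L^{d+1})⁻¹·Σ_{ρρ′} latticeKernel (M (n·L) s (Tsub τ ρ) (Tsub σ ρ′)) x`. -/
theorem latticeKernel_avgM (n L : ℕ) [NeZero n] [NeZero L] (s : ℕ) (τ σ : Fin (d + 1) → Fin n) (x : Fin (d + 1) → ℤ) :
    latticeKernel (avgM n L s τ σ) x = ((L : ℂ) ^ (d + 1))⁻¹ * (((L : ℂ) ^ (d + 1))⁻¹ *
      ∑ ρ : Fin (d + 1) → Fin L, ∑ ρ' : Fin (d + 1) → Fin L, latticeKernel (M (n * L) s (Tsub n L τ ρ) (Tsub n L σ ρ')) x) := by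
  rw [avgM_eq_Phi', latticeKernel_Phi]
  have e : ∀ T : Fin (d + 1) → Fin (n * L), ∑ T' : Fin (d + 1) → Fin (n * L),
      conj (cellVec n L τ T) * cellVec n L σ T' * latticeKernel (M (n * L) s T T') x
      = conj (cellVec n L τ T) * (((L : ℂ) ^ (d + 1))⁻¹ *
          ∑ ρ' : Fin (d + 1) → Fin L, latticeKernel (M (n * L) s T (Tsub n L σ ρ')) x) := fun T => by
    rw [← sum_cellVec_mul n L σ (fun T' => latticeKernel (M (n * L) s T T') x), Finset.mul_sum]
    refine Finset.sum_congr rfl fun T' _ => ?_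
    ring
  simp_rw [e]
  rw [sum_conj_cellVec_mul n L τ
      (fun T => ((L : ℂ) ^ (d + 1))⁻¹ * ∑ ρ' : Fin (d + 1) → Fin L, latticeKernel (M (n * L) s T (Tsub n L σ ρ')) x),
    ← Finset.mul_sum]

/-- [folklore] **THE LEVEL-FREE EXPONENTIAL MAJORANT OF THE TWO-LEG CELL AVERAGE** (the uniform half of «(CONV-C)-Sb» in the lineage's currency):
for EVERY `n ≥ 1`, `L ≥ 1`, order `s`, cells `τ, σ` and block separation `x ∈ ℤ^{d+1}`,
`‖latticeKernel (avgM n L s τ σ) x‖ ≤ 4^{d+1}·Kop (d+1) s·((L:ℝ)^{d+1})⁻¹·e^{−kappaB (d+1) s·|x|_∞}` — rate and prefactor free of `n`, decreasing in `L`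
(`ConstrainedBiLaplacianPairing.pairing_decay` at the two normalised cell indicators). -/
theorem subcell_decay (n L : ℕ) [NeZero n] [NeZero L] (s : ℕ) (τ σ : Fin (d + 1) → Fin n) (x : Fin (d + 1) → ℤ) :
    ‖latticeKernel (avgM n L s τ σ) x‖
      ≤ 4 ^ (d + 1) * Kop (d + 1) s * ((L : ℝ) ^ (d + 1))⁻¹ * Real.exp (-(kappaB (d + 1) s * supNorm x)) := by
  exact latticeKernel_decay (stripRegular_avgM n L s τ σ) (kappaB_pos (d + 1) s).le x

/-- [folklore] **THE SCALED FORM**: `‖(L^{d+1})·latticeKernel (avgM n L s τ σ) x‖ ≤ 4^{d+1}·Kop (d+1) s·e^{−kappaB (d+1) s·|x|_∞}` — the cell-PAIR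
density (sum over the `L^{2(d+1)}` finer pairs divided by `L^{d+1}`) is bounded UNIFORMLY IN THE REFINEMENT `L` and in the coarse level `n`. -/
theorem subcell_decay_scaled (n L : ℕ) [NeZero n] [NeZero L] (s : ℕ) (τ σ : Fin (d + 1) → Fin n) (x : Fin (d + 1) → ℤ) :
    ‖((L : ℂ) ^ (d + 1)) * latticeKernel (avgM n L s τ σ) x‖
      ≤ 4 ^ (d + 1) * Kop (d + 1) s * Real.exp (-(kappaB (d + 1) s * supNorm x)) := by
  have hL : (0 : ℝ) < (L : ℝ) ^ (d + 1) := by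
    have : (0 : ℝ) < L := by exact_mod_cast Nat.pos_of_ne_zero (NeZero.ne L)
    positivity
  have h := subcell_decay n L s τ σ x
  rw [norm_mul, norm_pow, Complex.norm_natCast]
  calc (L : ℝ) ^ (d + 1) * ‖latticeKernel (avgM n L s τ σ) x‖
      ≤ (L : ℝ) ^ (d + 1) * (4 ^ (d + 1) * Kop (d + 1) s * ((L : ℝ) ^ (d + 1))⁻¹ * Real.exp (-(kappaB (d + 1) s * supNorm x))) :=
        mul_le_mul_of_nonneg_left h hL.le
    _ = 4 ^ (d + 1) * Kop (d + 1) s * Real.exp (-(kappaB (d + 1) s * supNorm x)) := by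
        field_simp

/-- [folklore] **Q-FP-13-2, THE `j`-UNIFORM MAJORANT, PACKAGED** (fixed cells = the offsets of a fixed coarse level `n`, refinement `L → ∞`): there are
ONE rate `κ > 0` and ONE constant `C ≥ 0`, free of `n` and `L`, with `‖(L^{d+1})·latticeKernel (avgM n L s τ σ) x‖ ≤ C·e^{−κ|x|_∞}` for ALL
`n, L ≥ 1`, `τ, σ, x`.  Read at `n := Lc^m`, `L := Lc^j`: the doubly cell-averaged level-`Lc^{j+m}` kernel over `Lc^j`-cells, times `(Lc^j)^{d+1}`, is
`j`-uniformly exponentially bounded on the block scale (unit-lattice currency: a further `j`-free `×(Lc^m)^{2s}` and the displayed `×(Lc^j)^{2s}`, which the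
«unit rescaling» removes). -/
theorem subcell_tower_uniform (d s : ℕ) :
    ∃ κ C : ℝ, 0 < κ ∧ 0 ≤ C ∧ ∀ (n L : ℕ) [NeZero n] [NeZero L] (τ σ : Fin (d + 1) → Fin n) (x : Fin (d + 1) → ℤ),
      ‖((L : ℂ) ^ (d + 1)) * latticeKernel (avgM n L s τ σ) x‖ ≤ C * Real.exp (-(κ * supNorm x)) :=
  ⟨kappaB (d + 1) s, 4 ^ (d + 1) * Kop (d + 1) s, kappaB_pos (d + 1) s, by have := Kop_nonneg (d + 1) s; positivity,
    fun n L _ _ τ σ x => subcell_decay_scaled n L s τ σ x⟩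

end Summit.QuantumFields.BalabanUV.Beta.FP.ConstrainedBiLaplacianSubcell

end
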